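import Literature.Topology.PlanarFoliations.HugOrbit
import Literature.Topology.PlanarFoliations.LeafBase
import HarnessLib

/-!
# The cycle of separatrices of the periodic hugged walk

Topic: Topology / PlanarFoliations, sequel to `HugOrbit.lean` (the hugged walk is eventually
periodic, with pairwise distinct darts over a minimal period) and `WalkBuild.lean` (the walk of a
cycle of separatrices). A period of length `p` from the index `c` of the hugged walk is a **cycle
of separatrices** in the sense of `WalkBuild.lean`: the saddles `cvtx i` and the canonical leaf
points `csx i` of the states `c + i`, `i : Fin p` (`OrbitCycle`: `cvtx_mem`, `csx_mem`,
`omega_csx`, `alpha_csx` — the last one across the seam by the *literal* periodicity of the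
states); its leaves are pairwise distinct (`csx_leaf_injective`: equal leaves have equal
ω-saddles by `omegaSet_eq_of_mem_leaf` and equal arrival prongs, hence equal darts). The walk
`walkJ`, `walkℓ` of `WalkBuild.lean` around this cycle **turns to the side `s`**
(`cycJ_turn`, `walkJ_turn`: its prongs are those of the hugged walk by the uniqueness of tails,
`FwdTail.j_eq`, `BwdTail.j_eq`) and **the chain crosses the incoming star vertical of its first
junction on the side `s`** (`cross_walkJ`, transferred along the horizontal).

## References

* C. Camacho, A. Lins Neto, *Geometric Theory of Foliations*, Birkhäuser (1985), Ch. VII §2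
  [CamachoLinsNeto1985].
-/

noncomputable section

open Set Filter Function Metric unitInterval
open _root_.Topology
open Literature.Topology.FourManifolds Literature.Topology.FourManifolds.Foliation

namespace Literature.Topology.PlanarFoliations

namespace StarData

variable {X : Type*} [TopologicalSpace X] [T2Space X] [SecondCountableTopology X] [Nonempty X] {F : Foliation ℝ X} {ι : X → ℂ}
variable {B : Type*} [NormedAddCommGroup B] [NormedSpace ℝ B] {M : Type*} [TopologicalSpace M] {T : Foliation B M} {g : ℂ → M}
variable {D : StarData F ι T g} {hbi : IsBiOriented F} {hι : IsOpenEmbedding ι} {K : ℕ → X} {H : D.HugHyp hbi hι K}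

namespace HugData

variable (s : ℝ) (d₀ : HugData H) (c p : ℕ)

/-! ## The cycle datum -/

/-- **The saddles of the cycle**: the arrival saddles of the states `c + i`. [folklore] -/
def cvtx (i : Fin p) : ℂ := (seq s d₀ (c + i)).v

/-- **The separatrices of the cycle**: the canonical points of the states `c + i`. [folklore] -/
def csx (i : Fin p) : X := (seq s d₀ (c + i)).st.y

omit [NormedSpace ℝ B] in
/-- The separatrices of the cycle are line leaves. [folklore] -/
instance instNoncompactSpaceCsx (i : Fin p) : NoncompactSpace (F.Leaf (csx s d₀ c p i)) := (seq s d₀ (c + i)).nc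

omit [NormedSpace ℝ B] in
/-- The saddles of the cycle are punctures. [folklore] -/
theorem cvtx_mem (i : Fin p) : cvtx s d₀ c p i ∈ D.P := D.mem_P _ (seq s d₀ (c + i)).hv

omit [NormedSpace ℝ B] in
/-- The separatrices of the cycle lie in any set containing the first disc of the chain. [folklore] -/
theorem csx_mem {C : Set ℂ} (hsub : discLeaf F ι (K 0) ⊆ C) (i : Fin p) (q : F.Leaf (csx s d₀ c p i)) : ι (Leaf.pt q) ∈ C :=
  hsub (H.mem_disc (seq s d₀ (c + i)).st.hy q)

omit [NormedSpace ℝ B] in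
/-- **The ω-limit sets of the cycle.** [folklore] -/
theorem omega_csx (i : Fin p) : omegaSet hbi ι (csx s d₀ c p i) = {cvtx s d₀ c p i} := (seq s d₀ (c + i)).st.omegaSet_eq H

variable {s d₀ c p} [NeZero p]

omit [NormedSpace ℝ B] in
/-- Across the period, the state after `c + i` is the state `c + (i + 1)` read in `Fin p`. [folklore] -/
theorem seq_cidx_succ (hper : ∀ i, seq s d₀ (c + i + p) = seq s d₀ (c + i)) (i : Fin p) :
    seq s d₀ (c + ((i + 1 : Fin p) : ℕ)) = seq s d₀ (c + i + 1) := by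
  rcases Nat.lt_or_ge 1 p with hp | hp
  · have h1 : ((i + 1 : Fin p) : ℕ) = ((i : ℕ) + 1) % p := by rw [Fin.val_add, Fin.val_one', Nat.mod_eq_of_lt hp]
    rw [h1]
    by_cases h : (i : ℕ) + 1 < p
    · rw [Nat.mod_eq_of_lt h, Nat.add_assoc]
    · have hi : (i : ℕ) + 1 = p := le_antisymm i.isLt (not_lt.1 h)
      rw [show ((i : ℕ) + 1) % p = 0 by rw [hi, Nat.mod_self]]
      have := hper 0
      rw [show c + 0 + p = c + i + 1 by omega] at this
      exact this.symm
  · obtain rfl : p = 1 := le_antisymm hp (NeZero.pos p)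
    obtain rfl : i = 0 := Subsingleton.elim _ _
    have := hper 0
    simpa using this.symm

variable (ho : F.IsTransverselyOriented) (hs : s = 1 ∨ s = -1) (hcross : d₀.Cross s)
  (hper : ∀ i, seq s d₀ (c + i + p) = seq s d₀ (c + i))

include ho hs hcross hper in
/-- Across the period, the state `c + (i + 1)` is the next state of the state `c + i`. [folklore] -/
theorem seq_cidx_succ_eq_next (i : Fin p) :
    seq s d₀ (c + ((i + 1 : Fin p) : ℕ)) = (seq s d₀ (c + i)).next s (good_seq ho d₀ hs hcross (c + i)) :=
  (seq_cidx_succ hper i).trans (seq_succ_eq_next ho d₀ hs hcross _)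

include ho hs hcross hper in
/-- **The α-limit sets of the cycle.** [folklore] -/
theorem alpha_csx (i : Fin p) : alphaSet hbi ι (csx s d₀ c p (i + 1)) = {cvtx s d₀ c p i} := by
  have key : ∀ {y : X} (hy : y = ((seq s d₀ (c + i)).next s (good_seq ho d₀ hs hcross (c + i))).st.y) [NoncompactSpace (F.Leaf y)],
      alphaSet hbi ι y = {cvtx s d₀ c p i} := by
    intro y hy _
    subst hy
    exact (seq s d₀ (c + i)).alphaSet_next s _
  exact key (congrArg (fun d : HugData H ↦ d.st.y) (seq_cidx_succ_eq_next ho hs hcross hper i))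

include ho hs hcross hper in
/-- **A backward tail of the outgoing separatrix on the outgoing prong of the hugged walk.** [folklore] -/
theorem exists_bwdTail_csx (i : Fin p) :
    ∃ Eb : (seq s d₀ (c + i)).P.BwdTail hbi (csx s d₀ c p (i + 1)), Eb.j = (seq s d₀ (c + i)).jout s := by
  have key : ∀ {y : X} (hy : y = ((seq s d₀ (c + i)).next s (good_seq ho d₀ hs hcross (c + i))).st.y) [NoncompactSpace (F.Leaf y)],
      ∃ Eb : (seq s d₀ (c + i)).P.BwdTail hbi y, Eb.j = (seq s d₀ (c + i)).jout s := by
    intro y hy _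
    subst hy
    exact ⟨(seq s d₀ (c + i)).Eb s _, (seq s d₀ (c + i)).Eb_j s _⟩
  exact key (congrArg (fun d : HugData H ↦ d.st.y) (seq_cidx_succ_eq_next ho hs hcross hper i))

/-! ## The leaves of a minimal period are distinct -/

omit [NormedSpace ℝ B] [NeZero p] in
/-- **States with the same leaf have the same dart**: the ω-saddles agree (the ω-limit set does
not depend on the base point) and so do the arrival prongs (a tail rebased to the other copy of
the leaf is a tail there; tails of one leaf at one star are on one prong). [folklore] -/
theorem dart_eq_of_leaf_eq {a b : ℕ} (h : F.leaf (seq s d₀ a).st.y = F.leaf (seq s d₀ b).st.y) : (seq s d₀ a).dart = (seq s d₀ b).dart := by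
  have key : ∀ (d : HugData H) (y' : X) [NoncompactSpace (F.Leaf y')] (w : ℂ) (hw : D.nprong w ≠ 0)
      (E : (D.star w hw).FwdTail hbi y'), w = d.v → y' ∈ F.leaf d.st.y → d.dart = ⟨w, hw, E.j⟩ := by
    intro d y' _ w hw E hwv hm
    subst hwv
    -- `E` rebased to the leaf of `d.st.y` is a forward tail there, on the prong `E.j`
    let E'' : d.P.FwdTail hbi d.st.y :=
      { j := E.j
        p := Leaf.rebase hm E.p
        β₀ := E.β₀
        hβ₀ := E.hβ₀
        hp := E.hp
        fwd_iff := fun q ↦ by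
          rw [← (Leaf.rebase hm).apply_symm_apply q, rebase_mem_fwd_iff hm, E.fwd_iff]
          rfl
        mem_closure := by rw [image_fwd_rebase hm]; exact E.mem_closure }
    show (⟨d.v, d.hv, d.E.j⟩ : D.Dart) = ⟨d.v, hw, E.j⟩
    rw [ProngStar.FwdTail.j_eq d.E E'']
  set da := seq s d₀ a with hda
  set db := seq s d₀ b with hdb
  have hmem : db.st.y ∈ F.leaf da.st.y := by rw [h]; exact F.mem_leaf_self _
  -- the ω-saddles agree
  have hω : omegaSet hbi ι db.st.y = omegaSet hbi ι da.st.y := omegaSet_eq_of_mem_leaf hmem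
  have hv : db.v = da.v := by
    have h1 := db.st.omegaSet_eq H
    have h2 := da.st.omegaSet_eq H
    have h3 : ({db.v} : Set ℂ) = {da.v} := by
      show ({db.st.v H} : Set ℂ) = {da.st.v H}
      rw [← h1, ← h2]
      exact hω
    exact singleton_injective h3
  exact key da db.st.y db.v db.hv db.E hv hmem

omit [NormedSpace ℝ B] [NeZero p] in
/-- **The leaves of a minimal period are pairwise distinct.** [folklore] -/
theorem csx_leaf_injective (hdist : ∀ i j : ℕ, i < j → j < p → (seq s d₀ (c + i)).dart ≠ (seq s d₀ (c + j)).dart)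
    (a b : Fin p) (h : F.leaf (csx s d₀ c p a) = F.leaf (csx s d₀ c p b)) : a = b := by
  by_contra hab
  rcases lt_or_gt_of_ne (Fin.val_injective.ne hab) with hlt | hlt
  · exact hdist a b hlt b.isLt (dart_eq_of_leaf_eq h)
  · exact hdist b a hlt a.isLt (dart_eq_of_leaf_eq h.symm)

/-! ## The walk around the cycle turns to the side `s` -/

variable {C : Set ℂ} (hC : IsCompact C) (hsub : discLeaf F ι (K 0) ⊆ C)

include ho hs hcross hper in
/-- **The junctions of the walk around the cycle turn to the side `s`.** [folklore] -/
theorem cycJ_turn (i : Fin p) :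
    (D.cycJ hι hC (cvtx_mem s d₀ c p) (csx_mem s d₀ c p hsub) (omega_csx s d₀ c p) (alpha_csx ho hs hcross hper) i).jout =
      (D.cycJ hι hC (cvtx_mem s d₀ c p) (csx_mem s d₀ c p hsub) (omega_csx s d₀ c p) (alpha_csx ho hs hcross hper) i).turn s := by
  set jc := D.jc hι hC (cvtx_mem s d₀ c p) (csx_mem s d₀ c p hsub) (omega_csx s d₀ c p) (alpha_csx ho hs hcross hper) i with hjc
  have hin : jc.Ef.j = (seq s d₀ (c + i)).jin := ProngStar.FwdTail.j_eq jc.Ef (seq s d₀ (c + i)).E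
  obtain ⟨Eb, hEb⟩ := exists_bwdTail_csx ho hs hcross hper i
  have hout : jc.Eb.j = (seq s d₀ (c + i)).jout s := (ProngStar.BwdTail.j_eq jc.Eb Eb).trans hEb
  show jc.Eb.j = if 0 ≤ (seq s d₀ (c + i)).P.sg jc.Ef.j * s then jc.Ef.j + 1 else jc.Ef.j - 1
  rw [hout, hin]
  rfl

include ho hs hcross hper in
/-- **The walk around the cycle turns to the side `s`.** [folklore] -/
theorem walkJ_turn (k : ℕ) :
    (D.walkJ hι hC (cvtx_mem s d₀ c p) (csx_mem s d₀ c p hsub) (omega_csx s d₀ c p) (alpha_csx ho hs hcross hper) k).jout =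
      (D.walkJ hι hC (cvtx_mem s d₀ c p) (csx_mem s d₀ c p hsub) (omega_csx s d₀ c p) (alpha_csx ho hs hcross hper) k).turn s :=
  cycJ_turn ho hs hcross hper hC hsub _

include ho hcross hper in
/-- **The chain crosses the incoming star vertical of the first junction of the walk around the
cycle on the side `s`** (transferred from the hugged walk along the horizontals). [folklore] -/
theorem cross_walkJ : ∀ ε > 0, ∃ N, ∀ n ≥ N, ∃ h, 0 < s * h ∧ |h| < ε ∧
    (D.star _ (D.walkJ hι hC (cvtx_mem s d₀ c p) (csx_mem s d₀ c p hsub) (omega_csx s d₀ c p) (alpha_csx ho hs hcross hper) 0).hv).horiz hι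
      (D.walkJ hι hC (cvtx_mem s d₀ c p) (csx_mem s d₀ c p hsub) (omega_csx s d₀ c p) (alpha_csx ho hs hcross hper) 0).jin h
      (D.walkJ hι hC (cvtx_mem s d₀ c p) (csx_mem s d₀ c p hsub) (omega_csx s d₀ c p) (alpha_csx ho hs hcross hper) 0).β ∈ F.leaf (K n) := by
  intro ε hε
  set i₀ : Fin p := idx p 0 with hi₀
  set d := seq s d₀ (c + i₀) with hd
  set jc := D.jc hι hC (cvtx_mem s d₀ c p) (csx_mem s d₀ c p hsub) (omega_csx s d₀ c p) (alpha_csx ho hs hcross hper) i₀ with hjc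
  have hin : jc.Ef.j = d.jin := ProngStar.FwdTail.j_eq jc.Ef d.E
  have hβ' : jc.β ∈ Ioc 0 d.P.ρ := ⟨jc.hβin.1, jc.hβin.2.trans jc.Ef.hβ₀.2⟩
  obtain ⟨N, hN⟩ := (cross_seq' ho d₀ hs hcross (c + i₀)).out (min ε d.P.ρ) (lt_min hε d.P.ρ_pos)
  refine ⟨N, fun n hn ↦ ?_⟩
  obtain ⟨h, hsh, hhε, hmem⟩ := hN n hn
  have hhρ : |h| < d.P.ρ := hhε.trans_le (min_le_right _ _)
  have hh0 : h ≠ 0 := fun h0 ↦ by rw [h0, mul_zero] at hsh; exact lt_irrefl _ hsh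
  have hhI : h ∈ Icc (-d.P.ρ) d.P.ρ := ⟨(abs_lt.1 hhρ).1.le, (abs_lt.1 hhρ).2.le⟩
  refine ⟨h, hsh, hhε.trans_le (min_le_left _ _), ?_⟩
  show d.P.horiz hι jc.Ef.j h jc.β ∈ F.leaf (K n)
  rw [hin, ← leaf_eq_of_mem hmem]
  exact d.P.horiz_mem_leaf' hι ((d.P.mem_rect_iff).2 ⟨d.hβ, hhI⟩) ((d.P.mem_rect_iff).2 ⟨⟨hβ'.1.le, hβ'.2⟩, hhI⟩) (Or.inl hh0)

end HugData

end StarData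

end Literature.Topology.PlanarFoliations
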